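/-
Copyright (c) 2026 the pub-hodgecm-mathlib formalisation cell (harness21).  Prover seat hodgecm-mathlib-A-p13 (g40), second hand of LD1-p02 (g4)
on the ι-step (P4) of brick (Gα-C∞) `ArchLadder` (line LD1 of crux `HLiu418`), sub-brick (S1-ι) (LD1-p02 2026-09-02T11:28:09Z).  KERNEL module:
THEOREMS ONLY (no definition, no named fact, no `sorry`, no instance, no notation).
-/
import Literature.NumberTheory.GelbartRogawski1991.ArchLocalUnitarySurjective
import HarnessLib

/-!
# At a real place of MIXED sign the hyperbolic boost of the scaled Folland frame comes from an element of `U(σ_{w₀} diag dV)(ℂ)`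
# (sub-brick (S1-ι): the indefinite twin of ★ `ArchLocalUnitarySurjective.exists_archLocal_entries_eq_of_pos ∕ _of_neg`)

Topic `NumberTheory/GelbartRogawski1991`; namespace `Literature.NumberTheory.GelbartRogawski1991.GRConstruction` (that of ★ `ArchLocalUnitarySurjective`,
whose variables `(L) (e : Fin N × Fin 1 ≃ Fin n) (dV hdV hdV0) (dW hdW hdW0) (v₀)` and scalar dictionary ★ `signVec_cmGramEntry_line_apply`, ★
`embedding_cmPlaceOver_dV` this file continues).  KERNEL: theorems only.  Cell hodgecm-mathlib FLOOR 0, crux `HLiu418` = stmt-HodgeConjecture-24832,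
line LD1, brick (Gα-C∞) `ArchLadder`, ι-step (P4) of LD1-p02 (g4): the hypothesis `hu` of ★ `DoubledWeilRepresentationArchPlaceBoost.sectionD_archKPlace_apply_of_boost`
(Folland's section at the NON-COMPACT one-place boost) asks for an element `u ∈ U(σ_{w₀} diag dV)(ℂ)` whose scaled-frame matrix `D · (u ⊗ 1)^e · D⁻¹` is the
`SU(1,1)`-boost `B_t = [[ch t, −i sh t], [i sh t, ch t]]` planted at two line coordinates `kp ≠ km` of OPPOSITE sign (`0 < x_{v₀}(kp)`, `¬ 0 < x_{v₀}(km)`),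
the identity elsewhere.  At a DEFINITE place every unitary matrix is such a `W_u` (★ S1, `Bᴴ B = 1`); at the mixed place `ι` the right condition is
`Bᴴ Σ B = Σ`, `Σ = diag(sgn x_{v₀})`, which the boost satisfies (`ch² − sh² = 1`):

* §1 `conjTranspose_mul_diagonal_signs_mul_eq` (private) — `uᴴ · diag(c ε D²) · u = diag(c ε D²)` for `u = D⁻¹ B D`, `Bᴴ diag(ε) B = diag(ε)`, `D` real;
  `boostMatrix_conjTranspose_mul_diagonal_mul` — the planted boost satisfies `Bᴴ diag(ε) B = diag(ε)` whenever `ε kp = 1`, `ε km = −1`.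
* §2 **`exists_archLocal_entries_eq_boost (kp km) (hk : kp ≠ km) (hkp : 0 < x_{v₀} kp) (hkm : ¬ 0 < x_{v₀} km) (t)`**:
  `∃ u : U(σ_{w₀} diag dV)(ℂ), ∀ i i′, √|x i| · ((u ⊗ 1)^e)_{i i′} · (√|x i′|)⁻¹ = (B_t)_{i i′}` — the `hu` of ★ `sectionD_archKPlace_apply_of_boost` at `M = 1`,
  TOKEN FOR TOKEN.  Construction `u := D′⁻¹ · B_t^e · D′`, `D′_p = √|x_{v₀}(e(p,0))|`; membership `uᴴ σ_{w₀}(diag dV) u = σ_{w₀}(diag dV)` because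
  `σ_{w₀}(dV p) = (Im σ_{w₀}δ ∕ σ_{v₀}(dW 0)) · ε_p · D′_p²` with `ε_p = sgn x_{v₀}(e(p,0))` (★ `signVec_cmGramEntry_line_apply`, ★ `sqrtAbs_sq`).

HONEST SCOPE.  Statements about the tree's own archimedean unitary groups ([Folland1989, §4.2 (4.24), Prop. (4.39)]; [KonnoKonno2007, §3.1 (3.1), §3.3]);
nothing of [Liu2021] is asserted.  HC_CM is proved only modulo the 7 printed citations (2 remaining: hLiu418 = stmt-HodgeConjecture-24832, h413 =
stmt-HodgeConjecture-24833) until rung 0 closes; this file books nothing and discharges nothing booked (a `--supports` helper of line LD1).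

## References
* [Folland1989] G. B. Folland, *Harmonic Analysis in Phase Space* (1989), §4.2 (4.24), Prop. (4.39).
* [KonnoKonno2007] K. Konno, T. Konno, Kyushu J. Math. 61 (2007), §3.1 (3.1) (sign frames at a real place), §3.3 (the split component `A` of `U(p,q)`).
* [PlatonovRapinchuk1994] V. Platonov, A. Rapinchuk, *Algebraic Groups and Number Theory* (1994), §2.3.
-/

set_option autoImplicit false

noncomputable section

open scoped Classical
open scoped Matrix Kronecker ComplexOrder
open NumberField NumberField.InfinitePlace
open Complex (I)
open Literature.NumberTheory.Automorphic Literature.NumberTheory.Automorphic.UnitaryGroup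
open Literature.NumberTheory.Weil1964

namespace Literature.NumberTheory.GelbartRogawski1991.GRConstruction

open UnitaryDualPair

variable (L : Type) [Field L] [NumberField L] [IsCMField L]

variable {N n : ℕ} (e : Fin N × Fin 1 ≃ Fin n)
  (dV : Fin N → L) (hdV : ∀ i, IsCMField.complexConj L (dV i) = dV i) (hdV0 : ∀ i, dV i ≠ 0)
  (dW : Fin 1 → L) (hdW : ∀ i, IsCMField.complexConj L (dW i) = dW i) (hdW0 : ∀ i, dW i ≠ 0)
  (v₀ : {v : InfinitePlace (Fp L) // v.IsReal})

/-! ## §1 The matrix algebra: `uᴴ · diag(c ε D′²) · u = diag(c ε D′²)` for `u = D′⁻¹ B D′`, `Bᴴ diag(ε) B = diag(ε)`, `D′` real -/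

section Algebra

omit [NumberField L] [IsCMField L] in
/-- `uᴴ J u = J` for `u p q = D_p⁻¹ B p q D_q`, `J = diag (c · ε_p · D_p²)`, `Bᴴ diag(ε) B = diag(ε)`, `D` real and non-vanishing (entrywise computation).
[cite: KonnoKonno2007, §3.1 (3.1)] -/
private theorem conjTranspose_mul_diagonal_signs_mul_eq {N : ℕ} (B u : Matrix (Fin N) (Fin N) ℂ) (ε : Fin N → ℂ)
    (hB : Bᴴ * Matrix.diagonal ε * B = Matrix.diagonal ε) (d : Fin N → ℂ)
    (hd0 : ∀ p, d p ≠ 0) (hdr : ∀ p, star (d p) = d p) (c : ℂ) (hu : ∀ p q, u p q = (d p)⁻¹ * B p q * d q) :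
    uᴴ * Matrix.diagonal (fun p => c * ε p * (d p * d p)) * u = Matrix.diagonal (fun p => c * ε p * (d p * d p)) := by
  ext p q
  have hBB : ∀ p q : Fin N, ∑ l, star (B l p) * ε l * B l q = Matrix.diagonal ε p q := fun p q => by
    rw [← hB, Matrix.mul_apply]
    refine Finset.sum_congr rfl fun l _ => ?_
    rw [Matrix.mul_diagonal, Matrix.conjTranspose_apply]
  rw [Matrix.mul_apply]
  have hterm : ∀ l : Fin N, (uᴴ * Matrix.diagonal (fun p => c * ε p * (d p * d p))) p l * u l q =
      (c * d p * d q) * (star (B l p) * ε l * B l q) := fun l => by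
    rw [Matrix.mul_diagonal, Matrix.conjTranspose_apply, hu, hu, star_mul, star_mul, star_inv₀, hdr l, hdr p]
    field_simp [hd0 l]
  rw [Finset.sum_congr rfl fun l _ => hterm l, ← Finset.mul_sum, hBB, Matrix.diagonal_apply, Matrix.diagonal_apply]
  split_ifs with h
  · subst h; ring
  · rw [mul_zero]

omit [NumberField L] [IsCMField L] in
/-- **the planted boost preserves the sign form**: for `kp ≠ km`, `ε kp = 1`, `ε km = −1`, the matrix
`B_t = [[ch t, −i sh t], [i sh t, ch t]]` planted at `(kp, km)` (identity elsewhere) satisfies `B_tᴴ · diag(ε) · B_t = diag(ε)` (`ch² − sh² = 1`).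
[cite: KonnoKonno2007, §3.3] -/
theorem boostMatrix_conjTranspose_mul_diagonal_mul {n : ℕ} (kp km : Fin n) (hk : kp ≠ km) (ε : Fin n → ℂ) (hεp : ε kp = 1) (hεm : ε km = -1)
    (t : ℝ) :
    (Matrix.of fun i i' : Fin n =>
        if i = kp then (if i' = kp then (Real.cosh t : ℂ) else if i' = km then -(Real.sinh t : ℂ) * I else 0)
        else if i = km then (if i' = kp then (Real.sinh t : ℂ) * I else if i' = km then (Real.cosh t : ℂ) else 0)
        else if i = i' then 1 else 0)ᴴ * Matrix.diagonal ε *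
      (Matrix.of fun i i' : Fin n =>
        if i = kp then (if i' = kp then (Real.cosh t : ℂ) else if i' = km then -(Real.sinh t : ℂ) * I else 0)
        else if i = km then (if i' = kp then (Real.sinh t : ℂ) * I else if i' = km then (Real.cosh t : ℂ) else 0)
        else if i = i' then 1 else 0) = Matrix.diagonal ε := by
  set B : Matrix (Fin n) (Fin n) ℂ := (Matrix.of fun i i' : Fin n =>
        if i = kp then (if i' = kp then (Real.cosh t : ℂ) else if i' = km then -(Real.sinh t : ℂ) * I else 0)
        else if i = km then (if i' = kp then (Real.sinh t : ℂ) * I else if i' = km then (Real.cosh t : ℂ) else 0)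
        else if i = i' then 1 else 0) with hBdef
  have hmk : km ≠ kp := fun h => hk h.symm
  have hch : (Real.cosh t : ℂ) * (Real.cosh t : ℂ) - (Real.sinh t : ℂ) * (Real.sinh t : ℂ) = 1 := by
    rw [← Complex.ofReal_mul, ← Complex.ofReal_mul, ← Complex.ofReal_sub, ← sq, ← sq, Real.cosh_sq_sub_sinh_sq, Complex.ofReal_one]
  -- the entries of `B`
  have hpp : B kp kp = (Real.cosh t : ℂ) := by rw [hBdef, Matrix.of_apply, if_pos rfl, if_pos rfl]
  have hpm : B kp km = -(Real.sinh t : ℂ) * I := by rw [hBdef, Matrix.of_apply, if_pos rfl, if_neg hmk, if_pos rfl]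
  have hmp : B km kp = (Real.sinh t : ℂ) * I := by rw [hBdef, Matrix.of_apply, if_neg hmk, if_pos rfl, if_pos rfl]
  have hmm : B km km = (Real.cosh t : ℂ) := by rw [hBdef, Matrix.of_apply, if_neg hmk, if_pos rfl, if_neg hmk, if_pos rfl]
  have hpo : ∀ j, j ≠ kp → j ≠ km → B kp j = 0 := fun j h1 h2 => by
    rw [hBdef, Matrix.of_apply, if_pos rfl, if_neg h1, if_neg h2]
  have hmo : ∀ j, j ≠ kp → j ≠ km → B km j = 0 := fun j h1 h2 => by
    rw [hBdef, Matrix.of_apply, if_neg hmk, if_pos rfl, if_neg h1, if_neg h2]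
  have hoo : ∀ l j, l ≠ kp → l ≠ km → B l j = if l = j then 1 else 0 := fun l j h1 h2 => by
    rw [hBdef, Matrix.of_apply, if_neg h1, if_neg h2]
  ext i i'
  rw [Matrix.mul_apply]
  have hsum : ∀ l, (Bᴴ * Matrix.diagonal ε) i l * B l i' = star (B l i) * ε l * B l i' := fun l => by
    rw [Matrix.mul_diagonal, Matrix.conjTranspose_apply]
  rw [Finset.sum_congr rfl fun l _ => hsum l, Matrix.diagonal_apply]
  by_cases hi : i = kp ∨ i = km
  · -- `i` in the block: the summand is supported on `{kp, km}`
    rw [Fintype.sum_eq_add kp km hk (fun l hl => by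
      rw [hoo l i hl.1 hl.2, if_neg (by rintro rfl; rcases hi with h | h; exacts [hl.1 h, hl.2 h]), star_zero, zero_mul, zero_mul])]
    rw [hεp, hεm]
    rcases hi with rfl | rfl
    · rw [hpp, hmp]
      by_cases h1 : i' = i
      · subst h1
        rw [hpp, hmp, if_pos rfl, hεp]
        simp only [Complex.star_def, Complex.conj_ofReal, map_mul, Complex.conj_I]
        linear_combination hch + ((Real.sinh t : ℂ)) ^ 2 * Complex.I_sq
      · rw [if_neg (Ne.symm h1)]
        by_cases h2 : i' = km
        · subst h2
          rw [hpm, hmm]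
          simp only [Complex.star_def, Complex.conj_ofReal, map_mul, Complex.conj_I]
          ring
        · rw [hpo i' h1 h2, hmo i' h1 h2, mul_zero, mul_zero, add_zero]
    · rw [hpm, hmm]
      by_cases h1 : i' = i
      · subst h1
        rw [hpm, hmm, if_pos rfl, hεm]
        simp only [Complex.star_def, Complex.conj_ofReal, map_mul, map_neg, Complex.conj_I]
        linear_combination (-1 : ℂ) * hch - ((Real.sinh t : ℂ)) ^ 2 * Complex.I_sq
      · rw [if_neg (Ne.symm h1)]
        by_cases h2 : i' = kp
        · subst h2
          rw [hpp, hmp]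
          simp only [Complex.star_def, Complex.conj_ofReal, map_mul, map_neg, Complex.conj_I]
          ring
        · rw [hpo i' h2 h1, hmo i' h2 h1, mul_zero, mul_zero, add_zero]
  · -- `i` off the block: the summand is supported at `l = i`
    push Not at hi
    rw [Fintype.sum_eq_single i (fun l hl => by
      by_cases h1 : l = kp
      · subst h1
        rw [hpo i hi.1 hi.2, star_zero, zero_mul, zero_mul]
      · by_cases h2 : l = km
        · subst h2
          rw [hmo i hi.1 hi.2, star_zero, zero_mul, zero_mul]
        · rw [hoo l i h1 h2, if_neg hl, star_zero, zero_mul, zero_mul])]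
    rw [hoo i i hi.1 hi.2, hoo i i' hi.1 hi.2, if_pos rfl, star_one, one_mul]
    split_ifs with h
    · rw [mul_one]
    · rw [mul_zero]

end Algebra

/-! ## §2 The core: `u := D′⁻¹ B D′ ∈ U(σ_{w₀} diag dV)(ℂ)` when `Bᴴ diag(ε) B = diag(ε)` and `σ_{w₀}(dV p) = c · ε_p · D′_p²` -/

section Surjective

include hdV0 in
/-- core (signs): from `Bᴴ · diag(ε) · B = diag(ε)` and ONE real `c` with `σ_{w₀}(dV p) = c · ε_p · D_{e(p,0)}²`, the matrix `u = D′⁻¹ B D′` is an element of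
`U(σ_{w₀} diag dV)(ℂ)` with the displayed entries. [cite: KonnoKonno2007, §3.1 (3.1)] [cite: PlatonovRapinchuk1994, §2.3] -/
private theorem exists_archLocal_coe_eq_of_signs (B : Matrix (Fin N) (Fin N) ℂ) (ε : Fin N → ℂ)
    (hB : Bᴴ * Matrix.diagonal ε * B = Matrix.diagonal ε) (c : ℝ)
    (hx0 : ∀ k, signVec (cmPlaceOver L) (cmGramEntry L e dV hdV dW hdW) (imagUnit L) v₀ k ≠ 0)
    (hc : ∀ p : Fin N, (cmPlaceOver L v₀).1.embedding (dV p) = (c : ℂ) * ε p * ((((sqrtAbs (signVec (cmPlaceOver L) (cmGramEntry L e dV hdV dW hdW) (imagUnit L) v₀) (e (p, 0)) : ℝ) : ℂ)) * (((sqrtAbs (signVec (cmPlaceOver L) (cmGramEntry L e dV hdV dW hdW) (imagUnit L) v₀) (e (p, 0)) : ℝ) : ℂ)))) :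
    ∃ u : UnitaryGroup.archLocal L N (Matrix.diagonal dV) (cmPlaceOver L v₀),
      (((u : UnitaryGroup.archLocal L N (Matrix.diagonal dV) (cmPlaceOver L v₀)) : GL (Fin N) ℂ) : Matrix (Fin N) (Fin N) ℂ) =
        Matrix.of (fun p q : Fin N => (((sqrtAbs (signVec (cmPlaceOver L) (cmGramEntry L e dV hdV dW hdW) (imagUnit L) v₀) (e (p, 0)) : ℝ) : ℂ))⁻¹ * B p q * (((sqrtAbs (signVec (cmPlaceOver L) (cmGramEntry L e dV hdV dW hdW) (imagUnit L) v₀) (e (q, 0)) : ℝ) : ℂ))) := by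
  have hd0 : ∀ p : Fin N, (((sqrtAbs (signVec (cmPlaceOver L) (cmGramEntry L e dV hdV dW hdW) (imagUnit L) v₀) (e (p, 0)) : ℝ) : ℂ)) ≠ 0 := fun p => Complex.ofReal_ne_zero.2 (sqrtAbs_ne_zero (hx0 _))
  have hdr : ∀ p : Fin N, star (((sqrtAbs (signVec (cmPlaceOver L) (cmGramEntry L e dV hdV dW hdW) (imagUnit L) v₀) (e (p, 0)) : ℝ) : ℂ)) = (((sqrtAbs (signVec (cmPlaceOver L) (cmGramEntry L e dV hdV dW hdW) (imagUnit L) v₀) (e (p, 0)) : ℝ) : ℂ)) := fun p => by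
    rw [Complex.star_def, Complex.conj_ofReal]
  have hJ : (Matrix.diagonal dV).map (cmPlaceOver L v₀).1.embedding =
      Matrix.diagonal (fun p : Fin N => (c : ℂ) * ε p * ((((sqrtAbs (signVec (cmPlaceOver L) (cmGramEntry L e dV hdV dW hdW) (imagUnit L) v₀) (e (p, 0)) : ℝ) : ℂ)) * (((sqrtAbs (signVec (cmPlaceOver L) (cmGramEntry L e dV hdV dW hdW) (imagUnit L) v₀) (e (p, 0)) : ℝ) : ℂ)))) := by
    rw [Matrix.diagonal_map (map_zero _)]
    exact congrArg Matrix.diagonal (funext fun p => hc p)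
  have hmem : (Matrix.of (fun p q : Fin N => (((sqrtAbs (signVec (cmPlaceOver L) (cmGramEntry L e dV hdV dW hdW) (imagUnit L) v₀) (e (p, 0)) : ℝ) : ℂ))⁻¹ * B p q * (((sqrtAbs (signVec (cmPlaceOver L) (cmGramEntry L e dV hdV dW hdW) (imagUnit L) v₀) (e (q, 0)) : ℝ) : ℂ))))ᴴ *
      (Matrix.diagonal dV).map (cmPlaceOver L v₀).1.embedding *
        Matrix.of (fun p q : Fin N => (((sqrtAbs (signVec (cmPlaceOver L) (cmGramEntry L e dV hdV dW hdW) (imagUnit L) v₀) (e (p, 0)) : ℝ) : ℂ))⁻¹ * B p q * (((sqrtAbs (signVec (cmPlaceOver L) (cmGramEntry L e dV hdV dW hdW) (imagUnit L) v₀) (e (q, 0)) : ℝ) : ℂ))) =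
      (Matrix.diagonal dV).map (cmPlaceOver L v₀).1.embedding := by
    rw [hJ]
    exact conjTranspose_mul_diagonal_signs_mul_eq B _ ε hB (fun p => (((sqrtAbs (signVec (cmPlaceOver L) (cmGramEntry L e dV hdV dW hdW) (imagUnit L) v₀) (e (p, 0)) : ℝ) : ℂ))) hd0 hdr c (fun p q => rfl)
  -- `det u ≠ 0`: `det uᴴ · det J · det u = det J ≠ 0`
  have hJdet : ((Matrix.diagonal dV).map (cmPlaceOver L v₀).1.embedding).det ≠ 0 := by
    rw [Matrix.diagonal_map (map_zero _), Matrix.det_diagonal]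
    exact Finset.prod_ne_zero_iff.2 fun p _ => (map_ne_zero _).2 (hdV0 p)
  have hdet : (Matrix.of (fun p q : Fin N => (((sqrtAbs (signVec (cmPlaceOver L) (cmGramEntry L e dV hdV dW hdW) (imagUnit L) v₀) (e (p, 0)) : ℝ) : ℂ))⁻¹ * B p q * (((sqrtAbs (signVec (cmPlaceOver L) (cmGramEntry L e dV hdV dW hdW) (imagUnit L) v₀) (e (q, 0)) : ℝ) : ℂ)))).det ≠ 0 := by
    intro h0
    have h := congrArg Matrix.det hmem
    rw [Matrix.det_mul, Matrix.det_mul, h0, mul_zero] at h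
    exact hJdet h.symm
  refine ⟨⟨Matrix.GeneralLinearGroup.mkOfDetNeZero _ hdet, ?_⟩, ?_⟩
  · rw [UnitaryGroup.mem_archLocal_iff_conjTranspose, Matrix.GeneralLinearGroup.val_mkOfDetNeZero]
    exact hmem
  · rw [Matrix.GeneralLinearGroup.val_mkOfDetNeZero]

include hdV0 hdW0 in
/-- the sign vector does not vanish (`dV, dW ≠ 0`, `Im σ_{w₀}(δ) ≠ 0`). [cite: KonnoKonno2007, §3.1 (3.1)] -/
private theorem signVec_line_ne_zero' (k : Fin n) : signVec (cmPlaceOver L) (cmGramEntry L e dV hdV dW hdW) (imagUnit L) v₀ k ≠ 0 :=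
  signVec_ne_zero (IsCMField.complexConj_ne_one L) (cmPlaceOver_smul L) (complexConj_imagUnit L) (imagUnit_ne_zero L)
    (cmGramEntry_ne_zero L e dV hdV dW hdW hdV0 hdW0) v₀ k

include hdW0 in
/-- `σ_{v₀}(dW 0) ≠ 0`. [cite: KonnoKonno2007, §3.1 (3.1)] -/
private theorem embedding_of_isReal_dW_ne_zero' :
    embedding_of_isReal v₀.2 (⟨dW 0, (IsCMField.complexConj_eq_self_iff (K := L) (dW 0)).1 (hdW 0)⟩ : Fp L) ≠ 0 := by
  refine (map_ne_zero_iff _ (RingHom.injective _)).2 ?_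
  exact fun h => hdW0 0 (congrArg Subtype.val h)

/-! ## §3 The boost at a mixed place is a `W_u` -/

include hdV0 hdW0 in
/-- **SUB-BRICK (S1-ι), MIXED PLACE: the planted `SU(1,1)`-boost is `W_u` for some `u ∈ U(σ_{w₀} diag dV)(ℂ)`** — with the entry formula `hu` of ★
`DoubledWeilRepresentationArchPlaceBoost.sectionD_archKPlace_apply_of_boost` at `M = 1` token for token:
`√|x i| · ((u ⊗ 1)^e)_{i i′} · (√|x i′|)⁻¹ = (B_t)_{i i′}`, `B_t = [[ch t, −i sh t], [i sh t, ch t]]` planted at two line coordinates `kp ≠ km` with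
`0 < x_{v₀}(kp)`, `¬ 0 < x_{v₀}(km)`, the identity elsewhere.  Construction `u := D′⁻¹ · B_t^e · D′` (`D′_p = √|x_{v₀}(e(p,0))|`); membership because
`σ_{w₀}(dV p) = (Im σ_{w₀}δ ∕ σ_{v₀}(dW 0)) · sgn(x_{v₀}(e(p,0))) · D′_p²` and `B_tᴴ diag(sgn x) B_t = diag(sgn x)` (§1).
[cite: Folland1989, §4.2 (4.24), Prop. (4.39)] [cite: KonnoKonno2007, §3.1 (3.1), §3.3] [cite: PlatonovRapinchuk1994, §2.3] -/
theorem exists_archLocal_entries_eq_boost (kp km : Fin n) (hk : kp ≠ km)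
    (hkp : 0 < signVec (cmPlaceOver L) (cmGramEntry L e dV hdV dW hdW) (imagUnit L) v₀ kp)
    (hkm : ¬ 0 < signVec (cmPlaceOver L) (cmGramEntry L e dV hdV dW hdW) (imagUnit L) v₀ km) (t : ℝ) :
    ∃ u : UnitaryGroup.archLocal L N (Matrix.diagonal dV) (cmPlaceOver L v₀),
      ∀ i i' : Fin n,
        (((sqrtAbs (signVec (cmPlaceOver L) (cmGramEntry L e dV hdV dW hdW) (imagUnit L) v₀) i : ℝ) : ℂ)) *
          Matrix.reindex e e
            ((((u : UnitaryGroup.archLocal L N (Matrix.diagonal dV) (cmPlaceOver L v₀)) : GL (Fin N) ℂ) : Matrix (Fin N) (Fin N) ℂ) ⊗ₖ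
              (1 : Matrix (Fin 1) (Fin 1) ℂ)) i i' *
          (((sqrtAbs (signVec (cmPlaceOver L) (cmGramEntry L e dV hdV dW hdW) (imagUnit L) v₀) i' : ℝ) : ℂ))⁻¹ =
        (if i = kp then (if i' = kp then (Real.cosh t : ℂ) else if i' = km then -(Real.sinh t : ℂ) * I else 0)
        else if i = km then (if i' = kp then (Real.sinh t : ℂ) * I else if i' = km then (Real.cosh t : ℂ) else 0)
        else if i = i' then 1 else 0) := by
  have hx0 := signVec_line_ne_zero' L e dV hdV hdV0 dW hdW hdW0 v₀
  -- the reindexing `f p := e (p, 0)` as an equivalence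
  let f : Fin N ≃ Fin n := (Equiv.prodUnique (Fin N) (Fin 1)).symm.trans e
  have hf : ∀ p, f p = e (p, 0) := fun p => rfl
  have hs0 := embedding_of_isReal_dW_ne_zero' L dW hdW hdW0 v₀
  have hδ0 : deltaIm (cmPlaceOver L) (imagUnit L) v₀ ≠ 0 :=
    deltaIm_ne_zero (IsCMField.complexConj_ne_one L) (cmPlaceOver_smul L) (complexConj_imagUnit L) (imagUnit_ne_zero L) v₀
  -- the signs and the boost matrix on `Fin n`
  set εn : Fin n → ℂ := fun i => if 0 < signVec (cmPlaceOver L) (cmGramEntry L e dV hdV dW hdW) (imagUnit L) v₀ i then 1 else -1 with hεn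
  set Bn : Matrix (Fin n) (Fin n) ℂ := Matrix.of fun i i' : Fin n => (if i = kp then (if i' = kp then (Real.cosh t : ℂ) else if i' = km then -(Real.sinh t : ℂ) * I else 0)
        else if i = km then (if i' = kp then (Real.sinh t : ℂ) * I else if i' = km then (Real.cosh t : ℂ) else 0)
        else if i = i' then 1 else 0) with hBn
  have hBn' : Bnᴴ * Matrix.diagonal εn * Bn = Matrix.diagonal εn :=
    boostMatrix_conjTranspose_mul_diagonal_mul kp km hk εn (by rw [hεn]; exact if_pos hkp) (by rw [hεn]; exact if_neg hkm) t
  -- transported to `Fin N` along `f`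
  have hB : (Bn.submatrix f f)ᴴ * Matrix.diagonal (εn ∘ f) * Bn.submatrix f f = Matrix.diagonal (εn ∘ f) := by
    rw [← Matrix.submatrix_diagonal_equiv, Matrix.conjTranspose_submatrix, Matrix.submatrix_mul_equiv, Matrix.submatrix_mul_equiv, hBn']
  -- `σ_{w₀}(dV p) = (δ / s) · ε_p · D_{e(p,0)}²`
  have hc : ∀ p : Fin N, (cmPlaceOver L v₀).1.embedding (dV p) =
      ((deltaIm (cmPlaceOver L) (imagUnit L) v₀ /
          embedding_of_isReal v₀.2 (⟨dW 0, (IsCMField.complexConj_eq_self_iff (K := L) (dW 0)).1 (hdW 0)⟩ : Fp L) : ℝ) : ℂ) *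
        (εn ∘ f) p * ((((sqrtAbs (signVec (cmPlaceOver L) (cmGramEntry L e dV hdV dW hdW) (imagUnit L) v₀) (e (p, 0)) : ℝ) : ℂ)) * (((sqrtAbs (signVec (cmPlaceOver L) (cmGramEntry L e dV hdV dW hdW) (imagUnit L) v₀) (e (p, 0)) : ℝ) : ℂ))) := fun p => by
    rw [embedding_cmPlaceOver_dV L dV hdV v₀ p]
    have hx := signVec_cmGramEntry_line_apply L e dV hdV dW hdW v₀ p
    rw [Function.comp_apply, hf, hεn]
    dsimp only
    rw [← Complex.ofReal_mul, ← sq, sqrtAbs_sq]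
    by_cases hp : 0 < signVec (cmPlaceOver L) (cmGramEntry L e dV hdV dW hdW) (imagUnit L) v₀ (e (p, 0))
    · rw [if_pos hp, abs_of_pos hp, hx, mul_one, ← Complex.ofReal_mul]
      congr 1
      field_simp
    · rw [if_neg hp, abs_of_nonpos (not_lt.1 hp), hx, mul_neg_one, ← Complex.ofReal_neg, ← Complex.ofReal_mul]
      congr 1
      field_simp
  obtain ⟨u, hu⟩ := exists_archLocal_coe_eq_of_signs L e dV hdV hdV0 dW hdW v₀ (Bn.submatrix f f) (εn ∘ f) hB _ hx0 hc
  refine ⟨u, fun i i' => ?_⟩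
  have hi : ∀ j : Fin n, e ((e.symm j).1, 0) = j := fun j => by
    have : ((e.symm j).1, (0 : Fin 1)) = e.symm j := Prod.ext rfl (Subsingleton.elim _ _)
    rw [this, Equiv.apply_symm_apply]
  have h1 : (1 : Matrix (Fin 1) (Fin 1) ℂ) (e.symm i).2 (e.symm i').2 = 1 := by
    rw [Subsingleton.elim (e.symm i).2 (e.symm i').2, Matrix.one_apply_eq]
  have hDi : (((sqrtAbs (signVec (cmPlaceOver L) (cmGramEntry L e dV hdV dW hdW) (imagUnit L) v₀) i : ℝ) : ℂ)) ≠ 0 := Complex.ofReal_ne_zero.2 (sqrtAbs_ne_zero (hx0 _))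
  have hDi' : (((sqrtAbs (signVec (cmPlaceOver L) (cmGramEntry L e dV hdV dW hdW) (imagUnit L) v₀) i' : ℝ) : ℂ)) ≠ 0 := Complex.ofReal_ne_zero.2 (sqrtAbs_ne_zero (hx0 _))
  have hBii : Bn i i' = (if i = kp then (if i' = kp then (Real.cosh t : ℂ) else if i' = km then -(Real.sinh t : ℂ) * I else 0)
        else if i = km then (if i' = kp then (Real.sinh t : ℂ) * I else if i' = km then (Real.cosh t : ℂ) else 0)
        else if i = i' then 1 else 0) := by rw [hBn, Matrix.of_apply]
  rw [← hBii, Matrix.reindex_apply, Matrix.submatrix_apply, Matrix.kroneckerMap_apply, hu, h1, Matrix.of_apply,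
    Matrix.submatrix_apply, hf, hf, hi, hi, mul_one]
  field_simp

end Surjective

end Literature.NumberTheory.GelbartRogawski1991.GRConstruction

end
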